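import Literature.NumberTheory.PAdicHodge.AinfRamifiedEtaPeriodTheta
import Literature.NumberTheory.PAdicHodge.AinfRamifiedTateModule
import Literature.NumberTheory.PAdicHodge.AinfWeierstrassRamifiedCellsWitness
import HarnessLib

/-!
# η-transversality for the ramified cell models: `∫_τ η ∉ Fil¹ B_dR⁺` for some Tate-module point `τ` (proofs only)

Topic `Literature/NumberTheory/PAdicHodge`; namespace `Literature.NumberTheory.PAdicHodge.AinfRamTop`. THEOREMS ONLY (no definition,
no named fact, no instance, no `sorry`). The link between the sequence-level η-period over the ramified base (`AinfRamifiedEtaPeriodTheta`: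
`R_p(u₁) ∉ p𝒪_{ℂ_F} ⇒ ∫_t η ∉ Fil¹`, with `R_p = mulDefect W p ∈ 𝒪_D⟦X⟧` evaluated through `𝒪_D → 𝒪_{ℂ_F}`), the Tate-module currency
`TatePtO F (W.map ψ) p` of `AinfRamifiedTateModule` (`ψ : 𝒪_D → 𝒪_F` over `F`), and the unconditional η-Hasse witnesses of
`AinfWeierstrassRamifiedCellsWitness` for the good supersingular `𝒪_D`-models of the three additive cells of crux K★:

* `map_map_mulDefect_ψ` — `(ψ_* R_p) ⊗ F = R_p(W ⊗ F)` (the `hRn` shape of the 𝒪_F-currency criterion);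
* `mulDefectC_eq_evalPt₁_map_ψ` — `R_p(u)` computed over `𝒪_D` equals `(ψ_* R_p)(u)` computed over `𝒪_F` (`LubinTate.evalPt₁_map_of_algebraMap_eq`);
* **`mulDefectC_not_mem_span_p`** — for `W ⊗_ψ 𝒪_F` with unit discriminant and supersingular reduction at the odd residue characteristic `p`:
  `‖p‖ < ‖u‖^p ⇒ R_p(u) ∉ p𝒪_{ℂ_F}`; hence **`etaPeriod_seqO_not_mem_filOne`**: `‖p‖ < ‖τ₁‖^p ⇒ ∫_τ η ∉ Fil¹`;
* **`exists_etaPeriod_seqO_not_mem_filOne_model`** — for the cell models `W_D = ⟨0,0,0,aϖ^{r₄},bϖ^{r₆}⟩` over `𝒪_D = ℤ_p[X]/(X^e − p)`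
  (`(p;e,r₄,r₆) ∈ {(5;3,1,0),(5;6,4,0),(7;4,0,2)}`, unit `64a³p^{t₄} + 432b²p^{t₆}`): **some `τ ∈ T_pŴ(𝒪_{ℂ_F})` has `∫_τ η ∉ Fil¹ B_dR⁺`**
  — the hypothesis `∃ τ, φ₂ τ ∉ Fil¹` of the socket `DeRhamOfTatePtOPeriods` / `DeRhamSupersingularRamifiedOfEtaHom` for `φ₂ = ∫η`.

BSD route EdixhovenFibreFiveSeven, crux `stmt-BirchSwinnertonDyer-22226` (hDR on the potentially supersingular cells, sub-unit (R1));
BSD / K★ are not proved by any of this.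

## References
* P. Colmez, *Périodes p-adiques des variétés abéliennes*, Math. Ann. 292 (1992), §2. [Colmez1992PeriodesAbeliennes]
* J.-P. Serre, *Propriétés galoisiennes des points d'ordre fini des courbes elliptiques*, Invent. Math. 15 (1972), §1.11. [Serre1972]
-/

noncomputable section

open Ideal Filter Topology Field WittVector MvPowerSeries ValuativeRel Polynomial

namespace Literature.NumberTheory.PAdicHodge

open Literature.NumberTheory.GaloisRepresentations
open Literature.NumberTheory.GaloisRepresentations.IsNonarchimedeanLocalField
open Literature.NumberTheory.GaloisRepresentations.LubinTate
open Literature.NumberTheory.EllipticCurves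

namespace AinfRamTop

variable {F : Type} [Field F] [ValuativeRel F] [TopologicalSpace F] [IsNonarchimedeanLocalField F] [CharZero F]
  {p : ℕ} [Fact p.Prime] [Fact (¬ IsUnit (p : integerC F))] [IsAdicComplete (Ideal.span {(p : integerC F)}) (integerC F)]
  {hp : valuation F p < 1} {D : EisensteinRoot F p hp} {hθ : Function.Surjective (fontaineTheta (integerC F) p)}
  (W : WeierstrassCurve (EisensteinRoot.CoeffDisc D)) (ψ : EisensteinRoot.CoeffDisc D →+* LTCoeff F)
  (hψ : ∀ c, algebraMap (LTCoeff F) F (ψ c) = EisensteinRoot.CoeffDisc.toF D c)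

/-! ## §1 `R_p` in the two currencies -/

include hψ in
/-- **`(ψ_* R_p) ⊗ F = R_p(W ⊗ F)`**: the `hRn` hypothesis of the `𝒪_F`-currency criterion `AinfTop.mulDefect_evalPt₁_not_mem_span_p`
for `Rn := ψ_*(mulDefect W p)`. [cite: Colmez1992PeriodesAbeliennes, §2] -/
theorem map_map_mulDefect_ψ (n : ℕ) :
    PowerSeries.map (algebraMap (LTCoeff F) F) (PowerSeries.map ψ (mulDefect (hθ := hθ) W n)) =
      ((W.map ψ).map (algebraMap (LTCoeff F) F)).formalQuasiPeriodMulDefect n := by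
  have hcomp : (algebraMap (LTCoeff F) F).comp ψ = EisensteinRoot.CoeffDisc.toF D := RingHom.ext fun c => hψ c
  rw [← RingHom.comp_apply, ← PowerSeries.map_comp, hcomp, map_mulDefect_toF, map_ψ_map_algebraMap W ψ hψ]

omit [Fact (¬ IsUnit (p : integerC F))] [IsAdicComplete (Ideal.span {(p : integerC F)}) (integerC F)] in
/-- Constant term of `ψ_* R`. [cite: Colmez1992PeriodesAbeliennes, §2] -/
theorem constantCoeff_map_ψ {R : PowerSeries (EisensteinRoot.CoeffDisc D)} (hR : PowerSeries.constantCoeff R = 0) :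
    PowerSeries.constantCoeff (PowerSeries.map ψ R) = 0 := by
  rw [← PowerSeries.coeff_zero_eq_constantCoeff_apply, PowerSeries.coeff_map, PowerSeries.coeff_zero_eq_constantCoeff_apply, hR, map_zero]

include hψ in
/-- **`R_p(u)` over `𝒪_D` is `(ψ_* R_p)(u)` over `𝒪_F`** (change of coefficient ring in the evaluation, `𝒪_D → 𝒪_F → 𝒪_{ℂ_F} = 𝒪_D → 𝒪_{ℂ_F}`).
[cite: Colmez1992PeriodesAbeliennes, §2] -/
theorem mulDefectC_eq_evalPt₁_map_ψ (u : (maxNilIdealC F).toIdeal) :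
    mulDefectC hθ W u = (evalPt₁ (maxNilIdealC F) (PowerSeries.map ψ (mulDefect (hθ := hθ) W p))
      (constantCoeff_map_ψ ψ (constantCoeff_mulDefect W p)) u : CBall F) := by
  rw [mulDefectC, LubinTate.evalPt₁_map_of_algebraMap_eq ψ (algebraMap_ψ_eq ψ hψ)]

/-! ## §2 Transversality on the Tate module of `W ⊗_ψ 𝒪_F` -/

include hψ in
/-- **`‖p‖ < ‖u‖^p ⇒ R_p(u) ∉ p𝒪_{ℂ_F}`** for `W ⊗_ψ 𝒪_F` with unit discriminant and supersingular reduction at the odd residue characteristic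
`p` (the tree's 𝒪_F-currency η-Hasse criterion, read on `mulDefectC`). [cite: Colmez1992PeriodesAbeliennes, §2] -/
theorem mulDefectC_not_mem_span_p [CharP 𝓀[F] p] (hp2 : p ≠ 2) (hΔ : IsUnit (W.map ψ).Δ)
    (hA : ((W.map ψ).map (AinfTop.redCoeff F)).hasseCoeff p = 0) (u : (maxNilIdealC F).toIdeal)
    (hpu : ‖(p : CompletedAlgClosure F)‖ < ‖((u : CBall F) : CompletedAlgClosure F)‖ ^ p) :
    mulDefectC hθ W u ∉ Ideal.span {(p : CBall F)} := by
  rw [mulDefectC_eq_evalPt₁_map_ψ W ψ hψ]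
  exact AinfTop.mulDefect_evalPt₁_not_mem_span_p (W.map ψ) hp2 hΔ hA (map_map_mulDefect_ψ W ψ hψ p) _ u hpu

include hψ in
/-- **`‖p‖ < ‖τ₁‖^p ⇒ ∫_τ η ∉ Fil¹ B_dR⁺`** for `τ ∈ T_pŴ(𝒪_{ℂ_F})` of `W ⊗_ψ 𝒪_F` (good supersingular, `p` odd): the sequence-level
transversality `etaPeriod_not_mem_filOne` at `t = seqO τ`. [cite: Colmez1992PeriodesAbeliennes, §2] -/
theorem etaPeriod_seqO_not_mem_filOne [CharP 𝓀[F] p] (hp2 : p ≠ 2) (hΔ : IsUnit (W.map ψ).Δ)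
    (hA : ((W.map ψ).map (AinfTop.redCoeff F)).hasseCoeff p = 0) (τ : AinfTop.TatePtO F (W.map ψ) p)
    (hτ : ‖(p : CompletedAlgClosure F)‖ < ‖((AinfTop.seqO (W.map ψ) τ 1 : CBall F) : CompletedAlgClosure F)‖ ^ p) :
    etaPeriod W hθ (AinfTop.seqO (W.map ψ) τ) (AinfTop.seqO_zero _ τ) (mulPC_seqO W ψ hψ τ) ∉ (BdRPlusTop.filOne F p).toIdeal :=
  etaPeriod_not_mem_filOne W _ _ (mulDefectC_not_mem_span_p W ψ hψ hp2 hΔ hA _ hτ)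

/-! ## §3 The cell models -/

omit [Fact (¬ IsUnit (p : integerC F))] [IsAdicComplete (Ideal.span {(p : integerC F)}) (integerC F)] in
/-- Reading the literal model through `ψ ∘ of` is reading its `CoeffDisc`-copy through `ψ`. [folklore] -/
private theorem model_map_map (a b : ℤ_[p]) (r₄ r₆ : ℕ) :
    ((⟨0, 0, 0, AdjoinRoot.of D.poly a * AdjoinRoot.root D.poly ^ r₄, AdjoinRoot.of D.poly b * AdjoinRoot.root D.poly ^ r₆⟩ :
        WeierstrassCurve D.Coeff).map (EisensteinRoot.CoeffDisc.of D).toRingHom).map ψ =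
      (⟨0, 0, 0, AdjoinRoot.of D.poly a * AdjoinRoot.root D.poly ^ r₄, AdjoinRoot.of D.poly b * AdjoinRoot.root D.poly ^ r₆⟩ :
        WeierstrassCurve D.Coeff).map (ψ.comp (EisensteinRoot.CoeffDisc.of D).toRingHom) :=
  WeierstrassCurve.map_map _ _ _

include hψ in
/-- **η-transversality for the ramified cell models**: for `W_D = ⟨0,0,0,aϖ^{r₄},bϖ^{r₆}⟩` over `𝒪_D = ℤ_p[X]/(X^e − p)` with
`p ∈ {5, 7}`, `3r₄ = e t₄`, `2r₆ = e t₆`, `64a³p^{t₄} + 432b²p^{t₆} ∈ ℤ_pˣ`, `r₄ > 0` at `5` and `r₆ > 0` at `7` (good SUPERSINGULAR reduction),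
read through any bridge `ψ : 𝒪_D → 𝒪_F` over `F`: **some `τ ∈ T_pŴ(𝒪_{ℂ_F})` has `∫_τ η ∉ Fil¹ B_dR⁺(F)`** (the witness `τ` with
`‖p‖ < ‖τ₁‖^p` of `exists_tatePtO_norm_p_lt_norm_pow_model`, and `‖R_p(τ₁)‖ = ‖τ₁‖^p > ‖p‖`). [cite: Colmez1992PeriodesAbeliennes, §2]
[cite: Serre1972, §1.11] -/
theorem exists_etaPeriod_seqO_not_mem_filOne_model [CharP 𝓀[F] p] {e : ℕ} (hD : D.poly = Polynomial.X ^ e - Polynomial.C (p : ℤ_[p]))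
    (a b : ℤ_[p]) {r₄ r₆ t₄ t₆ : ℕ} (hp57 : p = 5 ∨ p = 7) (h₄ : 3 * r₄ = e * t₄) (h₆ : 2 * r₆ = e * t₆)
    (hu : IsUnit (64 * a ^ 3 * (p : ℤ_[p]) ^ t₄ + 432 * b ^ 2 * (p : ℤ_[p]) ^ t₆)) (hr₄ : p = 5 → 0 < r₄) (hr₆ : p = 7 → 0 < r₆) :
    ∃ τ : AinfTop.TatePtO F (((⟨0, 0, 0, AdjoinRoot.of D.poly a * AdjoinRoot.root D.poly ^ r₄,
        AdjoinRoot.of D.poly b * AdjoinRoot.root D.poly ^ r₆⟩ : WeierstrassCurve D.Coeff).map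
          (EisensteinRoot.CoeffDisc.of D).toRingHom).map ψ) p,
      etaPeriod ((⟨0, 0, 0, AdjoinRoot.of D.poly a * AdjoinRoot.root D.poly ^ r₄,
          AdjoinRoot.of D.poly b * AdjoinRoot.root D.poly ^ r₆⟩ : WeierstrassCurve D.Coeff).map (EisensteinRoot.CoeffDisc.of D).toRingHom)
        hθ (AinfTop.seqO _ τ) (AinfTop.seqO_zero _ τ) (mulPC_seqO _ ψ hψ τ) ∉ (BdRPlusTop.filOne F p).toIdeal := by
  have hp2 : p ≠ 2 := by rcases hp57 with rfl | rfl <;> norm_num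
  set WD : WeierstrassCurve (EisensteinRoot.CoeffDisc D) := (⟨0, 0, 0, AdjoinRoot.of D.poly a * AdjoinRoot.root D.poly ^ r₄,
      AdjoinRoot.of D.poly b * AdjoinRoot.root D.poly ^ r₆⟩ : WeierstrassCurve D.Coeff).map (EisensteinRoot.CoeffDisc.of D).toRingHom
    with hWD
  have hΔ : IsUnit (WD.map ψ).Δ := by
    rw [hWD, model_map_map]
    exact AinfTop.isUnit_Δ_map_model hD _ a b h₄ h₆ hu
  have hA : ((WD.map ψ).map (AinfTop.redCoeff F)).hasseCoeff p = 0 := by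
    rw [hWD, model_map_map]
    exact AinfTop.hasseCoeff_red_map_model_eq_zero hD _ a b hp57 hr₄ hr₆
  obtain ⟨τ, -, hτ⟩ := AinfTop.exists_tatePtO_norm_p_lt_norm_pow_model (F := F) hD (ψ.comp (EisensteinRoot.CoeffDisc.of D).toRingHom)
    a b hp57 h₄ h₆ hu hr₄ hr₆
  -- `(W_D.map of).map ψ = W_D.map (ψ ∘ of)` definitionally, so `τ` is a point of the Tate module in the statement
  exact ⟨τ, etaPeriod_seqO_not_mem_filOne WD ψ hψ hp2 hΔ hA τ hτ⟩

end AinfRamTop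

end Literature.NumberTheory.PAdicHodge

end
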